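/-
Copyright (c) 2026. All rights reserved.
Released under Apache 2.0 license as described in the file LICENSE.
-/
import Mathlib.MeasureTheory.Measure.Haar.Unique
import Mathlib.MeasureTheory.Integral.Bochner.Basic
import Mathlib.MeasureTheory.Constructions.BorelSpace.Basic
import HarnessLib

/-!
# Crux `HLiu418`, G6-arch ASSEMBLY FILE 11 (generic layer of the (E8) record bridge): a Haar measure on a group that is HOMEOMORPHICALLY
# ISOMORPHIC to an additive locally compact second countable group `E` (e.g. `N_Δ(L⁺ ⊗ ℝ) ≅ ∏_w Herm₂(ℂ) ≅ ℝ^{4σ}` through the tube frames)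
# integrates like a CONSTANT MULTIPLE of the additive Haar measure: `∫_N G(Φ u) dν(u) = c · ∫_E G dμ` for every `G`

Cell `hodgecm-mathlib`, crux item hLiu418 = `stmt-HodgeConjecture-24832` (helper lane `--supports`, count-neutral).  LEAD BATCH #53 (2) ∕ K2Liu-p13 (g4) desk
16:40:35Z «prefer the ∀-Haar form»: ★ (E3) `exists_eulerHead_intertwiningDelta` gives SOME σ-finite Haar `ν_∞` on `unipDeltaArch`; this file is the measure-theoretic
half of turning `∫ dν_∞` into `c · ∫_{∏_w Herm₂(ℂ)} db` (the other half — the frame map `Φ` with `Φ(uv) = Φ u + Φ v`, a homeomorphism onto `∏_w Herm₂`, from ★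
`K2LiuHermitianTubeFrameArch` ∕ ★ `archPiEquiv` — is record bookkeeping).  Mathlib only: the push-forward `Φ_* ν` is finite on compacts and left-invariant (`Φ` intertwines
left translations), hence `Φ_* ν = addHaarScalarFactor(Φ_* ν, μ) • μ` (★ Mathlib `isAddLeftInvariant_eq_smul`), and `∫ G ∘ Φ dν = ∫ G d(Φ_* ν)` (`Homeomorph.measurableEmbedding`).
* `isFiniteMeasureOnCompacts_map`, `isAddLeftInvariant_map_of_mulHom` — the two instances; **`exists_integral_comp_eq_smul`** — `∃ c : ℝ≥0, ∀ G, ∫ G (Φ u) ∂ν = c • ∫ G ∂μ`.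
References: [Folland1995, §2.2 (uniqueness of Haar measure)]; [BorelJacquet1979, §4.1].
HONEST LABEL: HC_CM is proved only modulo the 7 printed citations (2 remaining named inputs: hLiu418 = stmt-HodgeConjecture-24832,
h413 = stmt-HodgeConjecture-24833) until rung 0 closes; count-neutral helper, closes no socket.
-/

set_option autoImplicit false
set_option linter.dupNamespace false

noncomputable section

open MeasureTheory MeasureTheory.Measure
open scoped NNReal ENNReal

namespace Summit.HodgeConjecture.HodgeConjecture.Cruxes.HLiu418.K2LiuArchUnipotentHaarTransport

variable {N : Type*} [Group N] [TopologicalSpace N] [ContinuousMul N] [MeasurableSpace N] [BorelSpace N]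
  {E : Type*} [AddGroup E] [TopologicalSpace E] [IsTopologicalAddGroup E] [MeasurableSpace E] [BorelSpace E]

omit [Group N] [ContinuousMul N] [AddGroup E] [IsTopologicalAddGroup E] in
/-- the push-forward of a measure finite on compacts along a homeomorphism is finite on compacts. [folklore] -/
theorem isFiniteMeasureOnCompacts_map [T2Space E] (Φ : N ≃ₜ E) (ν : Measure N) [IsFiniteMeasureOnCompacts ν] :
    IsFiniteMeasureOnCompacts (Measure.map Φ ν) :=
  ⟨fun K hK => by
    rw [Measure.map_apply Φ.continuous.measurable hK.measurableSet]
    exact (Φ.isCompact_preimage.2 hK).measure_lt_top⟩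

/-- **left-invariance transports**: if the homeomorphism `Φ : N ≃ₜ E` turns products into sums (`Φ(uv) = Φ u + Φ v`), the push-forward of a left-invariant measure on `N`
is a left-invariant measure on the additive group `E`. [folklore] -/
theorem isAddLeftInvariant_map_of_mulHom (Φ : N ≃ₜ E) (hΦ : ∀ u v : N, Φ (u * v) = Φ u + Φ v) (ν : Measure N) [ν.IsMulLeftInvariant] :
    (Measure.map Φ ν).IsAddLeftInvariant := by
  refine ⟨fun x => ?_⟩
  have hcomp : (fun y : E => x + y) ∘ (Φ : N → E) = (Φ : N → E) ∘ fun v : N => Φ.symm x * v := by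
    funext v
    simp only [Function.comp_apply, hΦ, Homeomorph.apply_symm_apply]
  rw [Measure.map_map (measurable_const_add x) Φ.continuous.measurable, hcomp,
    ← Measure.map_map Φ.continuous.measurable (measurable_const_mul (Φ.symm x)), map_mul_left_eq_self]

/-- **A HAAR MEASURE SEEN THROUGH A HOMEOMORPHIC ISOMORPHISM ONTO AN ADDITIVE GROUP INTEGRATES LIKE A CONSTANT MULTIPLE OF THE ADDITIVE HAAR MEASURE**:
`E` locally compact second countable with an additive Haar measure `μ`, `Φ : N ≃ₜ E` with `Φ(uv) = Φ u + Φ v`, `ν` left-invariant and finite on compacts on `N`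
⇒ `∃ c : ℝ≥0`, `∫ G (Φ u) dν(u) = c • ∫ G dμ` for EVERY `G` (no measurability needed: `Φ` is a measurable embedding). [Folland1995, §2.2] -/
theorem exists_integral_comp_eq_smul [T2Space E] [LocallyCompactSpace E] [SecondCountableTopology E] (μ : Measure E) [μ.IsAddHaarMeasure]
    (Φ : N ≃ₜ E) (hΦ : ∀ u v : N, Φ (u * v) = Φ u + Φ v) (ν : Measure N) [IsFiniteMeasureOnCompacts ν] [ν.IsMulLeftInvariant]
    {F : Type*} [NormedAddCommGroup F] [NormedSpace ℝ F] :
    ∃ c : ℝ≥0, ∀ G : E → F, ∫ u, G (Φ u) ∂ν = c • ∫ x, G x ∂μ := by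
  haveI := isFiniteMeasureOnCompacts_map Φ ν
  haveI := isAddLeftInvariant_map_of_mulHom Φ hΦ ν
  refine ⟨addHaarScalarFactor (Measure.map Φ ν) μ, fun G => ?_⟩
  have h := isAddLeftInvariant_eq_smul (Measure.map Φ ν) μ
  rw [← Φ.measurableEmbedding.integral_map]
  calc ∫ y, G y ∂(Measure.map Φ ν) = ∫ y, G y ∂(addHaarScalarFactor (Measure.map Φ ν) μ • μ) := by rw [← h]
    _ = addHaarScalarFactor (Measure.map Φ ν) μ • ∫ x, G x ∂μ := integral_smul_nnreal_measure _ _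

end Summit.HodgeConjecture.HodgeConjecture.Cruxes.HLiu418.K2LiuArchUnipotentHaarTransport

end
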